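import Summits.CriticalPhenomena.PercolationContinuityZ3.Theorems.SahiMasterFamilyFCombFaceShiftDet

/-!
# The twisted face-domination kernel — definitions (support file for THEOREM R***-τ)

Support file (prover seat `prim-bnk-2`, gen 32; `--supports stmt-CriticalPhenomena-4575`).  Proof document
`run/shared/lean/prim/prim-l12/prim-bnk-2/PROOF-THEOREM-I1-STAR.md` §4.

Faces are pairs `(w, t)` of disjoint finsets over a coordinate list `l` (`w` = state `1`, `t` = state `2`, the rest state `0`).  For a set
`T` of TWISTED coordinates the kernel `faceInclT T l ℱ ℋ` has entry `1` at `(f, g)` iff every `a ∈ l` passes the per-coordinate incidence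
`(f, g) ∈ relPairs T a`: untwisted `a ∉ T`: state `1 ↦ 2`, `0 ↦ 1`, `2 ↦` anything (the kernel `m` of `…FaceShiftDet`); twisted `a ∈ T`:
`0 ↦ 2`, `1 ↦ {0,2}`, `2 ↦ {1,2}` (the kernel `m′ = [[0,0,1],[1,0,1],[0,1,1]]`) — the copy-order domination between the leavers and the slots
of SCHEME Σ* (Conjecture V for one-shared pairs with an arbitrary twist).  This file: the two plumbing definitions, the entry formula, the
dependence of `relPairs T a` on the four memberships of `a` only, row restriction, and the selection identity `K_𝒜ℬ ⅟K_ℬℬ K_ℬ𝒞 = K_𝒜𝒞`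
(`faceInclT_mul_invOf_mul`).  The unimodularity theorem is `…FaceShiftDetTwisted`.  No `sorry`; standard axioms.
-/

namespace Summit.CriticalPhenomena.PercolationContinuityZ3.Theorems

namespace SahiFComb.Shift

open Finset Matrix
open scoped Classical

variable {α : Type*} [DecidableEq α]

/-- The per-coordinate incidence of the twisted face-domination kernel at coordinate `a`, as a set of pairs of faces
`(f, g) = ((w,t), (w',t'))` (states: `1` = in `w`, `2` = in `t`, `0` = neither): untwisted `a ∉ T`: `1 ↦ 2`, `0 ↦ 1`, `2 ↦` anything;
twisted `a ∈ T`: `0 ↦ 2`, `1 ↦ {0,2}`, `2 ↦ {1,2}`. [this work] -/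
def relPairs (T : Finset α) (a : α) : Set ((Finset α × Finset α) × (Finset α × Finset α)) :=
  {p | if a ∈ T then (a ∉ p.1.1 → a ∉ p.1.2 → a ∈ p.2.2) ∧ (a ∈ p.1.1 → a ∉ p.2.1) ∧ (a ∈ p.1.2 → a ∈ p.2.1 ∨ a ∈ p.2.2)
    else (a ∈ p.1.1 → a ∈ p.2.2) ∧ (a ∉ p.1.1 → a ∉ p.1.2 → a ∈ p.2.1)}

/-- Membership in `relPairs`, unfolded. [this work] -/
theorem mem_relPairs {T : Finset α} {a : α} {f g : Finset α × Finset α} :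
    (f, g) ∈ relPairs T a ↔
      (if a ∈ T then (a ∉ f.1 → a ∉ f.2 → a ∈ g.2) ∧ (a ∈ f.1 → a ∉ g.1) ∧ (a ∈ f.2 → a ∈ g.1 ∨ a ∈ g.2)
        else (a ∈ f.1 → a ∈ g.2) ∧ (a ∉ f.1 → a ∉ f.2 → a ∈ g.1)) := Iff.rfl

/-- The twisted face-domination kernel between two families of faces over the coordinate list `l`. [this work] -/
noncomputable def faceInclT (T : Finset α) (l : List α) (ℱ ℋ : Finset (Finset α × Finset α)) : Matrix ℱ ℋ ℤ :=
  Matrix.of fun f g => if ∀ a ∈ l, ((f : Finset α × Finset α), (g : Finset α × Finset α)) ∈ relPairs T a then 1 else 0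

/-- Entries of the twisted kernel. [this work] -/
theorem faceInclT_apply (T : Finset α) (l : List α) (ℱ ℋ : Finset (Finset α × Finset α)) (f : ℱ) (g : ℋ) :
    faceInclT T l ℱ ℋ f g =
      if ∀ a ∈ l, ((f : Finset α × Finset α), (g : Finset α × Finset α)) ∈ relPairs T a then 1 else 0 := rfl

/-- Membership in `relPairs T a` only depends on the memberships of `a` in the four finsets. [this work] -/
theorem relPairs_congr {T : Finset α} {a : α} {f g f' g' : Finset α × Finset α} (h1 : a ∈ f.1 ↔ a ∈ f'.1)
    (h2 : a ∈ f.2 ↔ a ∈ f'.2) (h3 : a ∈ g.1 ↔ a ∈ g'.1) (h4 : a ∈ g.2 ↔ a ∈ g'.2) :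
    (f, g) ∈ relPairs T a ↔ (f', g') ∈ relPairs T a := by
  rw [mem_relPairs, mem_relPairs]
  simp only [h1, h2, h3, h4]

/-- Restricting the rows of the kernel to a subfamily. [this work] -/
theorem faceInclT_submatrix {T : Finset α} {l : List α} {𝒜 ℬ 𝒞 : Finset (Finset α × Finset α)} (h : 𝒜 ⊆ ℬ) :
    faceInclT T l 𝒜 𝒞 = (faceInclT T l ℬ 𝒞).submatrix (fun a => ⟨a.1, h a.2⟩) id := by
  ext a g; rfl

/-- The selection identity: for `𝒜 ⊆ ℬ` and `K_ℬℬ` invertible, `K_𝒜ℬ ⅟K_ℬℬ K_ℬ𝒞 = K_𝒜𝒞`. [this work] -/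
theorem faceInclT_mul_invOf_mul {T : Finset α} {l : List α} {𝒜 ℬ 𝒞 : Finset (Finset α × Finset α)} (h : 𝒜 ⊆ ℬ)
    [Invertible (faceInclT T l ℬ ℬ)] :
    faceInclT T l 𝒜 ℬ * ⅟(faceInclT T l ℬ ℬ) * faceInclT T l ℬ 𝒞 = faceInclT T l 𝒜 𝒞 := by
  set ι : ↥𝒜 → ↥ℬ := fun a => ⟨a.1, h a.2⟩ with hι
  have h1 : faceInclT T l 𝒜 ℬ * ⅟(faceInclT T l ℬ ℬ) = (1 : Matrix ℬ ℬ ℤ).submatrix ι id := by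
    calc faceInclT T l 𝒜 ℬ * ⅟(faceInclT T l ℬ ℬ)
        = (faceInclT T l ℬ ℬ).submatrix ι id * (⅟(faceInclT T l ℬ ℬ)).submatrix id id := by
          rw [faceInclT_submatrix h, Matrix.submatrix_id_id]
      _ = (faceInclT T l ℬ ℬ * ⅟(faceInclT T l ℬ ℬ)).submatrix ι id :=
          (Matrix.submatrix_mul _ _ ι id id Function.bijective_id).symm
      _ = (1 : Matrix ℬ ℬ ℤ).submatrix ι id := by rw [mul_invOf_self]
  calc faceInclT T l 𝒜 ℬ * ⅟(faceInclT T l ℬ ℬ) * faceInclT T l ℬ 𝒞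
      = (1 : Matrix ℬ ℬ ℤ).submatrix ι id * (faceInclT T l ℬ 𝒞).submatrix id id := by
        rw [h1, Matrix.submatrix_id_id]
    _ = ((1 : Matrix ℬ ℬ ℤ) * faceInclT T l ℬ 𝒞).submatrix ι id :=
        (Matrix.submatrix_mul _ _ ι id id Function.bijective_id).symm
    _ = faceInclT T l 𝒜 𝒞 := by rw [Matrix.one_mul, ← faceInclT_submatrix h]

end SahiFComb.Shift

end Summit.CriticalPhenomena.PercolationContinuityZ3.Theorems
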